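import Summits.BirchSwinnertonDyer.BirchSwinnertonDyer.Cruxes.PhantomShadow.KatoRepulsionSketch
import Summits.BirchSwinnertonDyer.BirchSwinnertonDyer.Cruxes.PhantomShadow.Disproof
import Summits.BirchSwinnertonDyer.BirchSwinnertonDyer.Theorems.ShadowIsolationPhantomShadowStubCentralVanishingOfFinite

/-!
# Transfer record for line `Sketch` (card `kato-repulsion-depth-certificate`) — lead c4, 2026-08-17

What the Sketch's typed objects (`KatoRepulsion.SignKeptLevel / EvenCongruentAt / AbsorbedOrInfinite /
PnIndependent`) compose to, kernel-checked, and what they do not.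

* `shadowAt_of_notAbsorbed` — GIVEN Kato Cor. 14.3 over the interface (`KatoFinite` = the registered
  `stub_katoFinite` = Literature fact p145371) and the card's provable residue `AbsorbedOrInfinite`, ONE
  sign-kept even congruent `A_g` whose `Ш` does NOT contain two `pⁿ`-independent classes yields the crux's
  conclusion `ShadowAt W p n` — but only for EVEN `W` (`rootNumber = 1`) with `shaCorank p ≠ 0`.
* `phantomShadow_evenDiv_of_sketch` — hence `AbsorbedOrInfinite ∧ KatoFinite ∧ NotAbsorbedSelection` prove
  the crux RESTRICTED to that sector. `NotAbsorbedSelection` is the residual stub; with `AbsorbedOrInfinite`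
  it implies `InfiniteSelection` (`infiniteSelection_of_notAbsorbed`), i.e. it is at least as strong, on
  this sector, as line `birth`'s promoted stub ("some even congruent `A_g` has infinite Mordell–Weil").
* Nothing in the Sketch speaks to ODD `W` (every Heegner/level-raising construction lands in the `-w`
  eigenspace, STRATEGY-CENSUS T2) or to the FINITE-`Ш[p^∞]` sector at depths `n ≤` exponent (the card and
  the strategist call it heuristically false); `PhantomShadow` quantifies over both.
Conclusion (L5): the transfer fails — `C⁺` (the Sketch's objects, even all granted) does not give the crux;
the only completion is a selection stub ≥ birth's promoted stub. Line `Sketch` is dead as a line for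
`PhantomShadow`; its durable content is L1 (`stub_twoIndependentShaOfExactOrder`, landed p162840) and the
typed pair (`AbsorbedOrInfinite`, `Isolation⁺`) for the planners of route SelmerRank / the Ш-gap.
-/

set_option linter.dupNamespace false

namespace Summit.BirchSwinnertonDyer.BirchSwinnertonDyer.Cruxes.PhantomShadow.SketchTransfer

open Summit.BirchSwinnertonDyer.BirchSwinnertonDyer.Theses.ShadowIsolation
open Summit.BirchSwinnertonDyer.BirchSwinnertonDyer.Cruxes.PhantomShadow.KatoRepulsion
open Summit.BirchSwinnertonDyer.BirchSwinnertonDyer.Cruxes.PhantomShadow.Disproof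
open Literature.NumberTheory.EllipticCurves
open Literature.NumberTheory.EllipticCurves.ModularForms

/-- Kato 2004 Cor. 14.3 over the `NewformAbelianVariety` interface — verbatim the registered stub
`stub_katoFinite` of line `birth` (= Literature fact
`kato_finite_mordellWeil_of_newformAbelianVariety`, p145371, unfolded). -/
def KatoFinite : Prop :=
  ∀ (N : ℕ) [NeZero N] (g : CuspForm (CongruenceSubgroup.Gamma0 N) 2), IsNewform0 g →
    ∀ (D : NewformAbelianVariety g) (Λ : ℂ → ℂ), Differentiable ℂ Λ →
      (∀ s : ℂ, 2 < s.re → Λ s = LSeries (fun m ↦ (UpperHalfPlane.qExpansion 1 ⇑g).coeff m) s) →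
      Λ 1 ≠ 0 → Finite (D.A.Points ℚ)

/-- The RESIDUAL SELECTION stub of any completion of the Sketch: for even `W` with a phantom
(`shaCorank p ≠ 0`), at every depth some sign-kept, even, strongly depth-`n` congruent `g` has Shimura data
`D` whose `Ш(A_g)` does NOT contain two `pⁿ`-independent classes ("is not absorbed"). -/
def NotAbsorbedSelection : Prop :=
  ∀ (W : WeierstrassCurve ℚ) [W.IsElliptic] [W.IsGloballyMinimal] (p : ℕ) [Fact p.Prime],
    5 ≤ p → W.HasGoodReductionAtPrime p → ¬ (p : ℤ) ∣ W.frobeniusTrace p →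
    W.HasIrreducibleModPGaloisRep p → W.rootNumber = 1 → W.shaCorank p ≠ 0 →
    ∀ n : ℕ, 1 ≤ n → ∃ (M : ℕ) (_ : NeZero (W.conductorNorm ℤ * M))
      (g : CuspForm (CongruenceSubgroup.Gamma0 (W.conductorNorm ℤ * M)) 2)
      (D : NewformAbelianVariety g),
      SignKeptLevel W p n M ∧ EvenCongruentAt W p n M g ∧ ¬ ∃ σ₁ σ₂ : ↥D.sha, PnIndependent p n σ₁ σ₂

/-- Line `birth`'s selection content on the same sector: some sign-kept even congruent `A_g` has
INFINITE Mordell–Weil group. -/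
def InfiniteSelection : Prop :=
  ∀ (W : WeierstrassCurve ℚ) [W.IsElliptic] [W.IsGloballyMinimal] (p : ℕ) [Fact p.Prime],
    5 ≤ p → W.HasGoodReductionAtPrime p → ¬ (p : ℤ) ∣ W.frobeniusTrace p →
    W.HasIrreducibleModPGaloisRep p → W.rootNumber = 1 → W.shaCorank p ≠ 0 →
    ∀ n : ℕ, 1 ≤ n → ∃ (M : ℕ) (_ : NeZero (W.conductorNorm ℤ * M))
      (g : CuspForm (CongruenceSubgroup.Gamma0 (W.conductorNorm ℤ * M)) 2)
      (D : NewformAbelianVariety g),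
      SignKeptLevel W p n M ∧ EvenCongruentAt W p n M g ∧ Infinite (D.A.Points ℚ)

/-- `NotAbsorbedSelection` is at least as strong as `InfiniteSelection`, granted the card's provable
residue `AbsorbedOrInfinite` (pure logic). -/
theorem infiniteSelection_of_notAbsorbed (hA : AbsorbedOrInfinite) (hSel : NotAbsorbedSelection) :
    InfiniteSelection := by
  intro W _ _ p _ h5 hgood hord hirr heven hdiv n hn
  obtain ⟨M, hM, g, D, hsk, hcong, hno⟩ := hSel W p h5 hgood hord hirr heven hdiv n hn
  refine ⟨M, hM, g, D, hsk, hcong, ?_⟩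
  rcases hA W p h5 hgood hord hirr heven hdiv n hn M hM g hsk hcong D with hinf | habs
  · exact hinf
  · exact (hno habs).elim

/-- One even congruent `A_g` with infinite Mordell–Weil gives the crux's conclusion `ShadowAt W p n`
(Kato contrapositive + Hecke continuation, the landed glue `stub_centralVanishing_of_finite`). -/
theorem shadowAt_of_infinite (hK : KatoFinite) (W : WeierstrassCurve ℚ) [W.IsElliptic] [W.IsGloballyMinimal]
    (p n M : ℕ) [hM : NeZero (W.conductorNorm ℤ * M)]
    (g : CuspForm (CongruenceSubgroup.Gamma0 (W.conductorNorm ℤ * M)) 2) (D : NewformAbelianVariety g)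
    (hsk : SignKeptLevel W p n M) (hcong : EvenCongruentAt W p n M g) (hinf : Infinite (D.A.Points ℚ)) :
    ShadowAt W p n := by
  obtain ⟨R, φ, hR, hnew, hmis, hw, hφ⟩ := hcong
  obtain ⟨Λ, hΛ, hagree, h1⟩ :=
    Theorems.stub_centralVanishing_of_finite (W.conductorNorm ℤ * M) g D (hK _ g hnew D) hinf
  exact ⟨M, hM, g, R, φ, hR, hsk.1, hsk.2.1, hnew, hmis, hw, hφ, Λ, hΛ, hagree, h1⟩

/-- Kato + `AbsorbedOrInfinite` + ONE non-absorbed sign-kept even congruent `A_g` ⇒ `ShadowAt W p n`,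
for EVEN `W` with `shaCorank p ≠ 0`. -/
theorem shadowAt_of_notAbsorbed (hA : AbsorbedOrInfinite) (hK : KatoFinite)
    (W : WeierstrassCurve ℚ) [W.IsElliptic] [W.IsGloballyMinimal] (p : ℕ) [Fact p.Prime]
    (h5 : 5 ≤ p) (hgood : W.HasGoodReductionAtPrime p) (hord : ¬ (p : ℤ) ∣ W.frobeniusTrace p)
    (hirr : W.HasIrreducibleModPGaloisRep p) (heven : W.rootNumber = 1) (hdiv : W.shaCorank p ≠ 0)
    (n : ℕ) (hn : 1 ≤ n) (M : ℕ) [hM : NeZero (W.conductorNorm ℤ * M)]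
    (g : CuspForm (CongruenceSubgroup.Gamma0 (W.conductorNorm ℤ * M)) 2) (D : NewformAbelianVariety g)
    (hsk : SignKeptLevel W p n M) (hcong : EvenCongruentAt W p n M g)
    (hno : ¬ ∃ σ₁ σ₂ : ↥D.sha, PnIndependent p n σ₁ σ₂) : ShadowAt W p n := by
  rcases hA W p h5 hgood hord hirr heven hdiv n hn M hM g hsk hcong D with hinf | habs
  · exact shadowAt_of_infinite hK W p n M g D hsk hcong hinf
  · exact (hno habs).elim

/-- **What the Sketch composes to**: the crux RESTRICTED to even `W` with a phantom, from
`AbsorbedOrInfinite` (card: provable residue, XL to vendor), Kato, and the residual selection stub. The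
sectors `rootNumber = -1` and `shaCorank p = 0` of `PhantomShadow` are untouched by every object of the
Sketch — this is the transfer failure recorded in `Lines/Sketch.dead.md`. -/
theorem phantomShadow_evenDiv_of_sketch (hA : AbsorbedOrInfinite) (hK : KatoFinite)
    (hSel : NotAbsorbedSelection) :
    ∀ (W : WeierstrassCurve ℚ) [W.IsElliptic] [W.IsGloballyMinimal] (p : ℕ) [Fact p.Prime],
      5 ≤ p → W.HasGoodReductionAtPrime p → ¬ (p : ℤ) ∣ W.frobeniusTrace p →
      W.HasIrreducibleModPGaloisRep p → W.rootNumber = 1 → W.shaCorank p ≠ 0 →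
      ∀ n : ℕ, 1 ≤ n → ShadowAt W p n := by
  intro W _ _ p _ h5 hgood hord hirr heven hdiv n hn
  obtain ⟨M, hM, g, D, hsk, hcong, hno⟩ := hSel W p h5 hgood hord hirr heven hdiv n hn
  exact shadowAt_of_notAbsorbed hA hK W p h5 hgood hord hirr heven hdiv n hn M g D hsk hcong hno

/-- The same sector from `birth`'s selection content directly (no `AbsorbedOrInfinite` needed): the
Sketch adds nothing toward the crux beyond re-expressing the selection. -/
theorem phantomShadow_evenDiv_of_infiniteSelection (hK : KatoFinite) (hSel : InfiniteSelection) :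
    ∀ (W : WeierstrassCurve ℚ) [W.IsElliptic] [W.IsGloballyMinimal] (p : ℕ) [Fact p.Prime],
      5 ≤ p → W.HasGoodReductionAtPrime p → ¬ (p : ℤ) ∣ W.frobeniusTrace p →
      W.HasIrreducibleModPGaloisRep p → W.rootNumber = 1 → W.shaCorank p ≠ 0 →
      ∀ n : ℕ, 1 ≤ n → ShadowAt W p n := by
  intro W _ _ p _ h5 hgood hord hirr heven hdiv n hn
  obtain ⟨M, hM, g, D, hsk, hcong, hinf⟩ := hSel W p h5 hgood hord hirr heven hdiv n hn
  exact shadowAt_of_infinite hK W p n M g D hsk hcong hinf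

end Summit.BirchSwinnertonDyer.BirchSwinnertonDyer.Cruxes.PhantomShadow.SketchTransfer
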